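import Literature.NumberTheory.Automorphic.AutomorphicQuotientKernelConvolution   -- ★ `mulStar` (`f^*(g) = conj f(g⁻¹)`), ★ `mulConv ν` (convolution)
import Mathlib.RepresentationTheory.Continuous.Basic
import Mathlib.GroupTheory.GroupAction.ConjAct
import Mathlib.Algebra.BigOperators.Finprod
import Mathlib.Data.Set.Card
import Mathlib.GroupTheory.DoubleCoset
import Mathlib.GroupTheory.Index
import HarnessLib

/-!
# Labesse–Langlands, *L-indistinguishability for SL(2)* (1979), §6 «Consequences»: the multiplicities `m(π)`,
# the numbers `e(π)`, `ε_π`, `µ(T′)`, the stabilised multiplicity `n(π)`, the stable distribution `f ↦ Σ n(π) trace π(f)`,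
# LEMMA 6.1 `n(π^g) = n(π)` AS PRINTED and the displayed objects of its proof (`l(π)`, `B`, (6.1), `X⁺`, `X⁻`); and (ED. 3)
# `G(π)`, `X(π̃)`, `Y`, `Y(π̃)`, `q(π)`, `A(π)`, `d(π)`, LEMMA 6.2, COROLLARY 6.3, PROPOSITIONS 6.4, 6.5, COROLLARY 6.6, PROPOSITIONS 6.7, 6.8 AS PRINTED

Topic `NumberTheory/Automorphic/LabesseLanglands1979`; namespace `Literature.NumberTheory.Automorphic.LabesseLanglands1979.Sec6`.
STATEMENTS ONLY (carpet, cell `hodgecm-mathlib`, squad TN «LN ∕ LS transfer», seat TN-t07 (g3), TN-plan DEAL v7; ED. 3 = seat TN-t07 (g4), TN-plan GO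
2026-09-02, append-only: LEMMA 6.2 – PROPOSITION 6.8 and their objects over the extension `QTable` of the dictionary): `structure`∕`def`s with bodies,
named facts `def … : Prop`, `rfl`∕`Iff.rfl` unfolding lemmas, and the closed identities inside PROPOSITIONS 6.7–6.8 proved as theorems;
**no `sorry`, no `axiom`, no `instance`, no `notation`, no attribute removal**.
Source: J.-P. Labesse, R. P. Langlands, *L-indistinguishability for SL(2)*, Canad. J. Math. 31 (1979) 726–785 [LabesseLanglands1979], §6.

PAGE PINS.  The held text (`lit read doi:10.4153/CJM-1979-070-3`, 69 pp.) is the authors' typescript reissue with its OWN pagination 1–69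
(file `pNNNN.txt` = reissue p. NN, running head «L-indistinguishability NN»); the Canad. J. Math. page numbers 726–785 do not occur in it and there
is no constant offset (69 reissue pages against 60 journal pages).  Every pin below is therefore «reissue p. N» (read on the materialised page); for
LEMMA 6.1 the journal pin «pp. 768–769» used by the 22 tree files that cite it (after [Rogawski1990, Prop. 13.8.1 p. 212]: «cf. [LL], page 768») is
kept alongside: §6 opens on reissue p. 46 (l. 82), Lemma 6.1 is stated on reissue p. 48 and proved on pp. 48–49 (= journal pp. 768–769).

## What the consumers state Lemma 6.1 as (census, `rg 'LabesseLanglands1979, Lemma 6.1' lean/Summits lean/Literature`, 22 files)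

1. ★ `Literature.NumberTheory.Automorphic.WeightedHilbertSchmidtVanishing` (PROVED: ★ `weightedHilbertSchmidtVanishing_holds`,
   `WeightedHilbertSchmidtVanishingProofs.lean`) — the abstract Hilbert-space MECHANISM of the printed PROOF (pp. 768–769): a real-weighted sum of
   Hilbert–Schmidt norms `Σ_i l_i ‖π_i(f)‖²_{HS}` over pairwise inequivalent irreducible unitary representations vanishing on a `*`-closed,
   product-closed, non-degenerate operator family forces `l = 0` (print's «all we need do is show that `X⁻` is empty» argument, with
   [JacquetLanglands1970, Lemma 16.1.1 p. 498]).
2. ★ `Rogawski1990.ArchCharactersLinIndep` ∕ `ArchCharactersRealCase` ∕ `archRealReduction` ∕ `ArchTestKc.mulStar`, `ArchTestKcConvolution`,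
   `ArchTestKcPackage`, `ArchTestKcBiAverage` — print's p. 768 sentences «`B` is closed under `f → f^*` … and under the obvious convolution product»,
   «`B` ample», instantiated at the archimedean test algebra of the cell's `U(2,1)`.
3. `Summits/…/Cruxes/H413/Lines/F0_T1a_ArchCharactersLinIndep.lean`, `…/F0_T1b_SemilocalCharactersLinIndep.lean`, `Theorems/F0T1aArchAssembly.lean`,
   `F0T1aArchRealCaseU21.lean`, `F0T1bSemilocalCharactersLinIndepOfStubs.lean` — LINEAR INDEPENDENCE OF CHARACTERS of irreducible unitary
   representations of one group (products on pure tensors by fibre regrouping), i.e. the conclusion shape of [Rogawski1990, Prop. 13.8.1] =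
   [JacquetLanglands1970, Lemma 16.1.1] = the proof of Lemma 6.1.
4. `Theorems/F0P3ClassificationLaws*.lean` law (L2), `Cruxes/H413/Lines/F0_T5InnerFormClassification.lean`: «(L2) LINEAR INDEPENDENCE OF CHARACTERS
   … [LabesseLanglands1979 p. 768]».
5. Nobody states the PRINTED lemma — `n(π^g) = n(π)` for `g ∈ G̃(A)` — or the §6 objects `m(π)`, `e(π)`, `ε_π`, `µ(T′)`, `n(π)` and the stable
   distribution `f ↦ Σ n(π) trace π(f)`; that is this file.  (The germ line `F0_P3a_N6nsGerm.lean` cites [LabesseLanglands1979, §2], squad file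
   `Sec2.lean`, not §6.)

## The dress («MULTIPLICITY DRESS»)

The objects of §5–§6 are global (adelic) and far from Mathlib; as in the squad's other carpets (★ `BorelWallach2000.DiscreteSeriesTable`,
★ `LanglandsShelstad1990Descent.Consequences`) they are carried by a DICTIONARY `MultiplicityTable G Gt` whose fields are the printed objects as
abstract DATA, and every printed definition∕assertion that relates them is either a genuine `def` over the dictionary (`eps`, `eNum`, `nOneTorus`,
`nThreeTori`, `l`, `XPlus`, `XMinus`) or a `def … : Prop` PREDICATE on the dictionary.  NOTHING IS ASSERTED: print's theorem = the predicate
HOLDS for the genuine data of §5–§6; a consumer takes `(h : T.LabesseLanglands1979_6_1_conjInvariance)` for ITS dictionary; `∀ T, …` is not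
claimed and no debt is created.  The parameters: `G` = print's group «`G = {g ∈ G̃(A_F) | det g ∈ A}`» of §5 (reissue p. 30: `F` a global field,
`A = ∏_v A_v` a closed subgroup of `I_F = GL(1, A_F)` with `F^× A` closed, `G̃ = GL(2)` or the group of units of a quaternion algebra, §2) — an
abstract group carrying the measure `ν` used for convolution; `Gt` = «`G̃(A)`», acting on representations of `G` by `π ↦ π^g`,
`π^g(h) = π(g h g⁻¹)` (Lemma 6.1) — an abstract type with the action `conj` as DATA (its concrete model on a representation space is
`conjRep`∕`conjRepNormal` below).  Test functions are genuine functions `G → ℂ`; print's `B` (p. 48: «the space of finite linear combinations of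
functions to which we have applied the trace formula», i.e. of the `f = ⊗ f_v` of §5 pp. 30–31) is a `ℂ`-submodule `T.B ≤ (G → ℂ)`; `f^*` and the
convolution product are the tree's ★ `Literature.NumberTheory.Automorphic.mulStar` and ★ `mulConv ν`; «trace π(f)» and «trace r(f)» are DATA
`T.tr π f`, `T.trR f` (print: `r(f) = ∫ f(g) r(g) dg` is of trace class, p. 31).  β-GUARD (squad QA rule on junk values of `∑'`): every printed
«`Σ … = 0`» ∕ «`Σ … = Σ …`» clause is paired with its `Summable` witness, since Mathlib's `∑'` returns `0` off summability.

## Index (print item ↦ declaration; pins = reissue pages)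

| print | declaration | kind |
|---|---|---|
| §6 «`m(π)` = multiplicity of `π` in `r`» (p. 46) | field `MultiplicityTable.m` | data |
| «`trace r(f) = Σ m(π) trace π(f)`» (p. 46) | `MultiplicityTable.traceDecomposition` | def (Prop) |
| «`π` is of type (a) ∕ (b) according as `θ` is» (p. 46) | `IsRepTypeA`, `IsRepTypeB` (types of `θ`: §5 pp. 42–43, DATA `IsTypeA∕B∕C`) | def (Prop) |
| «type (a): `π ∈ Π(θ₁)` only if `T₁`, `T′` stably conjugate; `T₁ = T′ ⇒ Π^±(θ_v) = Π^±(θ¹_v)`» (pp. 46–47) | `typeA_onlyStConj`, `typeA_signsAgree` | def (Prop) |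
| «`e(π)` = number of `θ` of `T′_F\T′` with `π ∈ Π(θ)`» (p. 47) | `eNum` | def (`ℕ`) |
| «`ε_{π_v} = ±1`, `= 1` for almost all `v`; `ε_π = ∏_v ε_{π_v}`» (p. 47) | `epsLoc_spec`; `eps` | def (Prop); def (`ℤ`) |
| «`n(π) = m(π) − ¼ ε_π e(π) µ(T′)`» (p. 47 l. 13) | `nOneTorus` | def (`ℚ`) |
| «`n(π) = m(π) − ¼ Σ_{i=1}^{3} ε_{i,π} e_i(π) µ(T_i)`» (p. 47 l. 25) | `nThreeTori` | def (`ℚ`) |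
| the definition of `n(π)` by cases (pp. 46–47) | field `n` + `nSpec` | data + def (Prop) |
| «`ε_{1,π_v} ε_{2,π_v} = ε_{3,π_v}`, `ε_{1,π} ε_{2,π} = ε_{3,π}`» (p. 47) | `eps_triple` | def (Prop) |
| «the distribution `f ↦ Σ_π n(π) trace π(f)` is stable» (p. 47) | `stable_nTrace` | def (Prop) |
| LEMMA 6.1 «`π^g : h ↦ π(g h g⁻¹)`; `n(π^g) = n(π)`» (p. 48; journal p. 768) | `conjRep`, `conjRepNormal`; `LabesseLanglands1979_6_1_conjInvariance` | def; def (Prop) |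
| proof: «`l(π) = n(π^g) − n(π)`» (p. 48) | `l` | def (`ℚ`) |
| proof: «`B` is closed under `f → f^*` and under convolution» (p. 48) | `IsStarConvClosed` | def (Prop) |
| proof: «`Σ l(π) trace π(f)` is absolutely convergent and equal to `0`» (p. 48) | `lTraceVanishes` | def (Prop) |
| proof: display (6.1) (p. 48) | `eq_6_1` | def (Prop) |
| proof: «`X⁺ = {l(π) > 0}`, `X⁻ = {l(π) < 0}`; all we need do is show that `X⁻` is empty» (p. 48) | `XPlus`, `XMinus`, `XMinusEmpty` | def (`Set`); def (Prop) |
| ED. 3 — the data of pp. 49–56 (`G̃(F)`, `det`, `F^×`, `A`, `π̃`, `π` on `G(𝐀)`, `ʰπ`, `m(π)` for `G′ = G(𝐀)`, characters of `I_F`, `ω ⊗ π̃`, `L`, `θ`, `π(θ)`) | `QTable` (extends `MultiplicityTable`) | structure (data) |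
| «`A_F = A ∩ F^×`» (§5 p. 30) | `QTable.AF` | def (`Subgroup`) |
| «`G(π) = G(π̃)` = the `h ∈ G̃(𝐀)` with `ʰπ ≃ π`» (p. 49) | `QTable.GPi` (+ `mem_GPi_iff`) | def (`Subgroup`) |
| «`A(π′) = A(π) = {det g : g ∈ G(π)}`» (Cor. 6.3, p. 52) | `QTable.APi` | def (`Subgroup`) |
| «`X(π) = X(π̃)` = the `ω` with `π̃ ≃ ω ⊗ π̃`»; «`Y` = characters of `F^×\I_F`»; «`Y(π̃)` = the `ω` with `ω ⊗ π̃` automorphic cuspidal» (p. 49) | `QTable.XChars`; `QTable.Y` (+ `mem_Y_iff`); `QTable.YPi` | def (`Set`); def (`Subgroup`); def (`Set`) |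
| «`q(π) = q(π̃) = [Y(π̃) ∕ Y X(π̃)]`» (p. 49) | `QTable.YX`, `QTable.q` | def (`Subgroup`); def (`ℕ`) |
| LEMMA 6.2 «`G′ = G(𝐀)`: `q(π) = Σ_{G̃(F)G(π)\G̃(𝐀)} m(ʰπ)`, finite» (p. 49) | `QTable.LabesseLanglands1979_6_2_qFormula` | def (Prop) |
| COROLLARY 6.3 «`q(π) = 1` ⇒ multiplicity of `π′` = `[A A(π) ∩ F^× A(π) : A_F A(π)] = [F^× ∩ A A(π) : A_F A(π)_F]`» (p. 52) | `QTable.corIndex`, `QTable.corIndex'`; `QTable.LabesseLanglands1979_6_3_multiplicity` | def (`ℕ`); def (Prop) |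
| «`d(π) = [A F^× ∩ A(π)F^× : F^×(A ∩ A(π))] = [A ∩ A(π)F^× : A_F(A ∩ A(π))]`», «`d(π′) = d(π)`» (p. 54) | `QTable.d`, `QTable.dRep` | def (`ℕ`) |
| the «=» of COROLLARY 6.3 (p. 52); «this is the index of Corollary 6.3» (p. 54) | theorems `QTable.corIndex'_eq_corIndex`, `QTable.corIndex_eq_d` (via `QTable.relIndex_sup_inf_sup`) | theorem |
| PROPOSITION 6.4 «`m(π^g) ≠ m(π)` for some `g` ⇒ `π ∈ Π(θ)` for some `θ`» (p. 52) | `QTable.LabesseLanglands1979_6_4_packetOfNonInvariant` | def (Prop) |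
| PROPOSITION 6.5 «`π ≃ ω ⊗ π`, `ω` quadratic ⇒ `π = π(θ)`, `θ` a character of `L^×\I_L`» (p. 52) | `QTable.LabesseLanglands1979_6_5_selfTwist` | def (Prop) |
| COROLLARY 6.6 «`θ` not through the norm ⇒ `q(π(θ)) = 1`» (p. 53) | `QTable.LabesseLanglands1979_6_6_qOne` | def (Prop) |
| PROPOSITION 6.7 «type (a): `n(π) = d(π)∕2`, `m(π) = d(π)(1 + ε_π)∕2`»; «`e(π)µ(T′) = 2d(π)`» (p. 56) | `QTable.LabesseLanglands1979_6_7_typeA`; `QTable.typeA_eMu`; theorem `QTable.LabesseLanglands1979_6_7_mFormula` | def (Prop); def (Prop); theorem |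
| PROPOSITION 6.8 «type (b): `n(π) = d(π)∕4`, `m(π) = d(π)(1 + ε_{1,π} + ε_{2,π} + ε_{3,π})∕4`»; «`e(π)µ(T′) = d(π)`» (p. 56) | `QTable.LabesseLanglands1979_6_8_typeB`; `QTable.typeB_eMu`; theorem `QTable.LabesseLanglands1979_6_8_mFormula` | def (Prop); def (Prop); theorem |

Deliberately NOT typed (not dealt ∕ already in the tree ∕ unnumbered): the Hilbert-space estimate of the proof of Lemma 6.1 (`λ(π)`, `δ`, the
Hilbert–Schmidt norm `‖π(f₁)‖`, JL p. 498) = ★ `WeightedHilbertSchmidtVanishing` (PROVED); §5's construction of `Π⁺(θ_v)`, `Π⁻(θ_v)`, `Π(θ)`, `𝔈(T′∕F)`,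
`𝔈(T′∕𝐀)`, `µ(T′) = [F^× ∩ A Nm I_L : A_F Nm L^×]` (pp. 36–42) — DATA here, squad file `Sec2.lean`∕§5 if ever dealt; the trace formula itself (§5);
the unnumbered displays and assertions between the numbered items of pp. 49–56 («`X(π̃)` consists of the characters trivial on `{det h | h ∈ G(π̃)}`»
p. 49, (6.2) p. 51, the global∕local equivalence count p. 54, (6.3) p. 55, the three-quadratic-extensions discussion p. 55, «`m(π′)` is `0` or `d(π′)`»
p. 56) — quoted in docstrings where they explain a numbered item, not typed (ED. 3 deal: numbered items only); the «more suggestive way to state the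
propositions» via the group `S⁰\S` (pp. 57–61) and §7.

TRANSCRIPTION CAVEATS (recorded, not resolved; the Lean text does not depend on them).  (i) The reissue's OCR drops the tilde of `G̃`: Lemma 6.1
reads «If `g ∈ G(A)`» in the file; it is `G̃(A)` — p. 49 ll. 14–16 («the set of all `h` in `G̃(A)` for which `ʰπ` … is equivalent to `π`», `π̃` a
representation of `G̃(A)`, `π` a component of its restriction to `G(A)`) and Lemma 6.2 (`Σ_{G̃(F)G(π)\G̃(𝐀)} m(ʰπ)`), and for `g ∈ G′` itself
`π^g ≃ π` makes the lemma empty.  (ii) ERRATUM (p. 47 l. 15): the reissue prints «If `π` is of type (c) there are three distinct quadratic extensions …»;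
read «type (b)» — p. 46 ll. 95–96 give a `π` a type only through a `θ` of type (a) or (b) («we say that `π` is of type (a) or type (b) according as
`θ` is of type (a) or (b)»), p. 43 ll. 15–31 place the three-quadratic-extension case `Π(θ₁) = Π(θ₂) = Π(θ₃)` under type (b), and PROPOSITION 6.8
(p. 56: «Suppose `π` is of type (b) and lies in `Π(θ₁)`, `Π(θ₂)`, `Π(θ₃)` … `n(π) = d(π)∕4`») and PROPOSITION 7.4 (p. 67: «If `π` is of type (b) we
introduce a group consisting of four elements `1, ε₁, ε₂, ε₃`») state the three-tori formula for `π` of type (b); accordingly `nSpec` keys its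
clause (iii) on `IsRepTypeB` (reviewer-review-p848602), and the §5 datum `IsTypeC` is carried but enters no §6 predicate.  (iii) The coefficient `¼` in both
formulas for `n(π)` (p. 47 ll. 12–14, 25–30, typeset as a built-up fraction) is confirmed by Prop. 6.7 (`e(π)µ(T′) = 2d(π)`, `n(π) = d(π)∕2`,
`m(π) = d(π)(1 + ε_π)∕2`) and Prop. 6.8 (`n(π) = d(π)∕4`), p. 56.  (iv) (ED. 3) The held text layer also drops PRIMES and the BOLD of the
adèle ring: read against the glyphs of a second build of the same typescript (see References), §5's group is «`G′ = {g ∈ G̃(𝐀_F) | det g ∈ A}`»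
(reissue p. 30 l. 10) with centre `Z′`, the subgroup `₀Z′ ≤ Z′` (pre-subscript `0`; ED. 1–2's docstrings write `⁰Z′`) and the character `χ` of `₀Z′`;
`G` itself is the algebraic group `SL(2)` or its twisted form (§2 p. 3), `G(𝐀)`, `G̃(𝐀)` are adelic points (bold `𝐀`), while `A` (italic) is the
subgroup of `I_F` — so ED. 1–2's «`G = {g ∈ G̃(A_F) | det g ∈ A}`», «`G̃(A)`», «`G_F\G`» denote print's `G′`, `G̃(𝐀)`, `G′_F\G′`: the dictionary
parameter `G` IS print's `G′`, and nothing in the Lean text changes.  ED. 3 keeps the three levels apart: `Gt` = `G̃(𝐀)`, `Rep` = representations of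
`G′`, `RepS` = representations of `G(𝐀)` (LEMMA 6.2 is the case «`G′ = G(𝐀)`»; COROLLARY 6.3 restricts a `π′` of `G′` to `G(𝐀)`).  The second build
writes `⟨ε, π⟩`, `⟨ε_i, π⟩` for the held text's `ε_π`, `ε_{i,π}` in PROPOSITIONS 6.7–6.8 and paginates differently (its p. 51 = held p. 49); all pins are to
the HELD reissue.  (v) (ED. 3) The index identities print asserts in passing — the two bracket expressions of COROLLARY 6.3 are equal, and `d(π)` «is the
index of Corollary 6.3» (p. 54 l. 16) — are identities between indices of subgroups of the commutative group `I_F` (all three numbers are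
`[X Y ∩ Z Y : (X ∩ Z) Y] = [X ∩ Y Z : (X ∩ Y)(X ∩ Z)]` for `{X, Y, Z} = {A, A(π), F^×}`); being closed statements they are PROVED (NOTE 7∕M4):
`QTable.relIndex_sup_inf_sup` (the identity), `QTable.corIndex'_eq_corIndex` (the «=» of COROLLARY 6.3), `QTable.corIndex_eq_d` (p. 54 l. 16), over
the typed objects `corIndex` (first bracket), `corIndex'` (second bracket), `d` (p. 54's defining display).

HONEST LABEL: named facts ∕ dictionary predicates; the theorems of ED. 3 are the closed algebra inside PROPOSITIONS 6.7–6.8 over the dictionary and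
the subgroup-index identities of COROLLARY 6.3 ∕ p. 54; nothing else here is proved or claimed for all data.

## References
* [LabesseLanglands1979] J.-P. Labesse, R. P. Langlands, *L-indistinguishability for SL(2)*, Canad. J. Math. 31 (1979) 726–785, §6
  (held reissue `paper:doi-10-4153-cjm-1979-070-3`, reissue pp. 46–49 (ED. 1–2) and pp. 49–56 (ED. 3: Lemma 6.2 p. 49, Cor. 6.3 – Prop. 6.5 p. 52,
  Cor. 6.6 p. 53, `d(π)` p. 54, Props. 6.7–6.8 p. 56), read 2026-09-02; Lemma 6.1 = journal pp. 768–769 after [Rogawski1990, p. 212]; the journal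
  pages of the rest of §6 are not held); reissue pp. 30–31, 36–37, 42–43 (§5) for the data.  Glyph check of ED. 3 (primes, tildes, bold, Fraktur;
  CAVEAT (iv)): the second build of the typescript at publications.ias.edu (`ll-ps.pdf`, 71 pp.), pp. 30, 48–49, 51, 53–58, read 2026-09-02 —
  used for reading only, never for pins.
* [JacquetLanglands1970] H. Jacquet, R. P. Langlands, *Automorphic Forms on GL(2)*, LNM 114 (1970), §16, Lemma 16.1.1 p. 498 (print's [6]).
* [Rogawski1990] J. D. Rogawski, *Automorphic Representations of Unitary Groups in Three Variables*, Ann. of Math. Stud. 123 (1990), Prop. 13.8.1 p. 212.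
-/

noncomputable section

open scoped BigOperators
open MeasureTheory

namespace Literature.NumberTheory.Automorphic.LabesseLanglands1979.Sec6

open Literature.NumberTheory.Automorphic (mulStar mulConv)

universe u v w

/-! ## LEMMA 6.1's `π^g` on a representation space (the concrete model of the dictionary's `conj`) -/

section ConjRep

variable {R : Type*} [Ring R] {V : Type*} [AddCommGroup V] [TopologicalSpace V] [IsTopologicalAddGroup V] [Module R V]
  {G : Type*} [Group G] {Gt : Type*} [Group Gt]

/-- **LEMMA 6.1, the representation `π^g`** (reissue p. 48): «If `g ∈ G̃(A)` define `π^g` by `π^g : h → π(g h g⁻¹)`.»  For a representation `π` of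
`G` on `V` (Mathlib `ContRepresentation`) and an action `c : Gt →* MulAut G` of «`G̃(A)`» on `G` by automorphisms (print: conjugation inside `G̃(A)`,
see `conjRepNormal`), `conjRep c g π = π ∘ c(g)`, i.e. `h ↦ π(c g h)` (Mathlib `ContRepresentation.restrict` along `c g`).
[cite: LabesseLanglands1979, Lemma 6.1 (reissue p. 48; journal p. 768)] -/
def conjRep (c : Gt →* MulAut G) (g : Gt) (π : ContRepresentation R G V) : ContRepresentation R G V :=
  π.restrict (c g).toMonoidHom

/-- `conjRep c g π h = π (c g h)` (definitional). [cite: LabesseLanglands1979, Lemma 6.1 (reissue p. 48; journal p. 768)] -/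
theorem conjRep_apply (c : Gt →* MulAut G) (g : Gt) (π : ContRepresentation R G V) (h : G) :
    conjRep c g π h = π (c g h) := rfl

/-- **`π^g : h ↦ π(g h g⁻¹)` literally** (reissue p. 48): `G` realised as a normal subgroup `N` of `Gt` = «`G̃(A)`» (print: `G = {det ∈ A}` is
normal in `G̃(A)`), `c = MulAut.conjNormal`, so that `conjRepNormal g π h = π ⟨g h g⁻¹, _⟩`. [cite: LabesseLanglands1979, Lemma 6.1 (reissue p. 48; journal p. 768)] -/
def conjRepNormal {N : Subgroup Gt} [N.Normal] (g : Gt) (π : ContRepresentation R N V) : ContRepresentation R N V :=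
  conjRep MulAut.conjNormal g π

/-- `conjRepNormal g π h = π (g h g⁻¹)` (the coercion of `MulAut.conjNormal g h` to `Gt` is `g * h * g⁻¹`, Mathlib `MulAut.conjNormal_apply`).
[cite: LabesseLanglands1979, Lemma 6.1 (reissue p. 48; journal p. 768)] -/
theorem conjRepNormal_apply {N : Subgroup Gt} [N.Normal] (g : Gt) (π : ContRepresentation R N V) (h : N) :
    conjRepNormal g π h = π (MulAut.conjNormal g h) := rfl

end ConjRep

/-! ## The §6 dictionary -/

/-- **Dictionary for Labesse–Langlands §6 (reissue pp. 46–48).**  Parameters: `G` = print's group «`G = {g ∈ G̃(A_F) | det g ∈ A}`» (§5, p. 30),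
`Gt` = «`G̃(A)`».  Fields (all DATA; the printed relations between them are the predicates below):
* `Rep` — irreducible admissible representations `π = ⊗ π_v` of `G`, up to equivalence (p. 46); `conj g π` — print's `π^g`, `π^g(h) = π(g h g⁻¹)`
  (Lemma 6.1, p. 48; concrete model `conjRep`);
* `m π` — «the multiplicity with which an irreducible admissible representation of `G` occurs in the representation `r`» (`r` = the representation
  of `G` on the space of cusp forms `L(G_F\G, χ)`, §5 p. 30), p. 46; `n π` — the number `n(π)` of pp. 46–47 (its printed definition by cases is
  `nSpec`);
* `B` — the space of test functions of §5 (pp. 30–31: `f = ⊗ f_v`, `f(zg) = χ(z) f(g)`, compact support mod `⁰Z′`, …; p. 48: «the space of finite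
  linear combinations of functions to which we have applied the trace formula»), as a `ℂ`-submodule of `G → ℂ`; `trR f` — «`trace r(f)`» (p. 31:
  `r(f)` is of trace class); `tr π f` — «`trace π(f)`»; `IsStable D` — «the distribution `D` is stable» (§4 p. 29 «stably invariant distributions», p. 47);
* `Pl` — the places `v` of `F`; `Car` — the Cartan subgroups `T′` of `G` attached to quadratic extensions `L` with «(5.13) `[E(T′∕A) : Im E(T′∕F)] = 2`»
  (§5 pp. 36, 42); `stConj` — stable conjugacy of such `T′` (p. 46); `mu T′` — «`µ(T′) = [F^× ∩ A Nm I_L : A_F Nm L^×]`» (§5 p. 37 l. 24);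
* `Ch` — the characters `θ` of `T′_F\T′` for such `T′` (`torusOf θ = T′`); `inPacket π θ` — «`π ∈ Π(θ)`», `Π(θ) = {⊗ π_v | π_v ∈ Π(θ_v) = Π⁺(θ_v) ∪ Π⁻(θ_v)}`
  (§5 p. 42 l. 23); `IsTypeA θ`, `IsTypeB θ`, `IsTypeC θ` — «we distinguish three types of `θ`» (§5 pp. 42–43, final classification p. 43 ll. 28–31;
  `IsTypeC` is §5 data only: p. 46 ll. 95–96 type a `π` through `θ` of type (a) or (b), so no §6 predicate reads it);
* `epsLoc θ π v` — «`ε_{π_v}`, `1` or `−1` according as `π_v ∈ Π⁺(θ_v)` or `π_v ∈ Π⁻(θ_v)`» (p. 47 l. 5; for the three-tori case `ε_{i,π_v}`, p. 47 l. 20).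
[cite: LabesseLanglands1979, §6 (reissue pp. 46–48)] -/
structure MultiplicityTable (G : Type u) (Gt : Type v) where
  /-- irreducible admissible representations of `G`, up to equivalence -/
  Rep : Type w
  /-- `π ↦ π^g`, `g ∈ G̃(A)` (Lemma 6.1) -/
  conj : Gt → Rep → Rep
  /-- `m(π)`, the multiplicity of `π` in `r` -/
  m : Rep → ℕ
  /-- `n(π)` -/
  n : Rep → ℚ
  /-- the test-function space `B` -/
  B : Submodule ℂ (G → ℂ)
  /-- `trace r(f)` -/
  trR : (G → ℂ) → ℂ
  /-- `trace π(f)` -/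
  tr : Rep → (G → ℂ) → ℂ
  /-- «the distribution is stable» -/
  IsStable : ((G → ℂ) → ℂ) → Prop
  /-- the places of `F` -/
  Pl : Type w
  /-- the Cartan subgroups `T′` with `[E(T′∕A) : Im E(T′∕F)] = 2` -/
  Car : Type w
  /-- stable conjugacy of Cartan subgroups -/
  stConj : Car → Car → Prop
  /-- `µ(T′)` -/
  mu : Car → ℕ
  /-- the characters `θ` of `T′_F\T′` -/
  Ch : Type w
  /-- the Cartan subgroup `T′` of which `θ` is a character -/
  torusOf : Ch → Car
  /-- `π ∈ Π(θ)` -/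
  inPacket : Rep → Ch → Prop
  /-- `θ` is of type (a) -/
  IsTypeA : Ch → Prop
  /-- `θ` is of type (b) -/
  IsTypeB : Ch → Prop
  /-- `θ` is of type (c) (§5 datum; read by no §6 predicate) -/
  IsTypeC : Ch → Prop
  /-- `ε_{π_v}` relative to `θ` -/
  epsLoc : Ch → Rep → Pl → ℤ

namespace MultiplicityTable

variable {G : Type u} {Gt : Type v} (T : MultiplicityTable.{u, v, w} G Gt)

/-! ### p. 46: `m(π)` and the spectral side -/

/-- **§6, «Then `trace r(f) = Σ m(π) trace π(f)`»** (reissue p. 46 ll. 82–90), for the test functions `f` of §5 (`f ∈ B`).  β-guard: the series is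
recorded together with its summability (print: `r(f)` is of trace class, p. 31, and `L(G_F\G, χ)` is a direct sum of irreducible representations,
p. 30). [cite: LabesseLanglands1979, §6 (reissue p. 46)] -/
def traceDecomposition : Prop :=
  ∀ f ∈ T.B, Summable (fun π : T.Rep => (T.m π : ℂ) * T.tr π f) ∧ T.trR f = ∑' π : T.Rep, (T.m π : ℂ) * T.tr π f

/-- «`π` belongs to no `Π(θ)` with `[E(T′∕A) : Im E(T′∕F)] = 2`» (reissue p. 46 l. 92) — the dictionary's `Ch` ranges exactly over the characters of
such `T′`. [cite: LabesseLanglands1979, §6 (reissue p. 46)] -/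
def InNoPacket (π : T.Rep) : Prop := ∀ θ : T.Ch, ¬ T.inPacket π θ

/-- **§6, «If `π` belongs to some such `Π(θ)` we say that `π` is of type (a) … according as `θ` is of type (a) …»** (reissue p. 46 ll. 95–96).
[cite: LabesseLanglands1979, §6 (reissue p. 46)] -/
def IsRepTypeA (π : T.Rep) : Prop := ∃ θ : T.Ch, T.inPacket π θ ∧ T.IsTypeA θ

/-- **§6, «… or type (b) according as `θ` is of type … (b)»** (reissue p. 46 ll. 95–96); the `π` of type (b) are those of the three-tori case
(p. 47 l. 15, printed there with the letter «(c)» — ERRATUM, see the module docstring, CAVEAT (ii); Prop. 6.8 p. 56).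
[cite: LabesseLanglands1979, §6 (reissue pp. 46–47)] -/
def IsRepTypeB (π : T.Rep) : Prop := ∃ θ : T.Ch, T.inPacket π θ ∧ T.IsTypeB θ

/-! ### pp. 46–47: type (a) — `e(π)`, `ε_π`, `n(π)` -/

/-- **§6 (reissue p. 46 l. 97 – p. 47 l. 1): «If `π` is of type (a) and `θ₁` is a character of `T₁` then `π` can belong to `Π(θ₁)` only if `T₁` and `T′`
are stably conjugate.»**  (`T′ = torusOf θ` for the type-(a) character `θ` with `π ∈ Π(θ)`.) [cite: LabesseLanglands1979, §6 (reissue pp. 46–47)] -/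
def typeA_onlyStConj : Prop :=
  ∀ (π : T.Rep) (θ θ₁ : T.Ch), T.inPacket π θ → T.IsTypeA θ → T.inPacket π θ₁ → T.stConj (T.torusOf θ₁) (T.torusOf θ)

/-- **§6 (reissue p. 47 ll. 1–5): «If `T₁ = T′` then `Π⁺(θ_v) = Π⁺(θ¹_v)`, `Π⁻(θ_v) = Π⁻(θ¹_v)` for all `v`.»**  Recorded through the signs: for a
type-(a) `θ` and a `θ₁` of the same Cartan subgroup with `π ∈ Π(θ) ∩ Π(θ₁)`, `ε_{π_v}` computed from `θ` and from `θ₁` agree at every place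
(this is what makes `ε_π` depend on `π` and `T′` only). [cite: LabesseLanglands1979, §6 (reissue p. 47)] -/
def typeA_signsAgree : Prop :=
  ∀ (π : T.Rep) (θ θ₁ : T.Ch), T.inPacket π θ → T.IsTypeA θ → T.inPacket π θ₁ → T.torusOf θ₁ = T.torusOf θ →
    ∀ v : T.Pl, T.epsLoc θ₁ π v = T.epsLoc θ π v

/-- **§6, `e(π)`** (reissue p. 47 l. 5): «Let `e(π)` be the number of characters of `T′_F\T′` for which `π ∈ Π(θ)`» — and, in the three-tori case
(p. 47 l. 19), «`e_i(π)` the number of characters of `T_i` trivial on `T_i ∩ G_F` for which `π ∈ Π(θ_i)`»: the number of `θ ∈ Ch` of the Cartan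
subgroup `T′` with `π ∈ Π(θ)` (`Set.ncard`; print's count is finite). [cite: LabesseLanglands1979, §6 (reissue p. 47)] -/
def eNum (T' : T.Car) (π : T.Rep) : ℕ := {θ : T.Ch | T.torusOf θ = T' ∧ T.inPacket π θ}.ncard

/-- **§6, the local signs** (reissue p. 47 ll. 5–6): «Let `ε_{π_v}` be `1` or `−1` according as `π_v ∈ Π⁺(θ_v)` or `π_v ∈ Π⁻(θ_v)`.  Then `ε_{π_v}` is
`1` for almost all `v`.»  For `π ∈ Π(θ)`: every `epsLoc θ π v` is `1` or `−1`, and all but finitely many are `1`.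
[cite: LabesseLanglands1979, §6 (reissue p. 47)] -/
def epsLoc_spec : Prop :=
  ∀ (π : T.Rep) (θ : T.Ch), T.inPacket π θ →
    (∀ v : T.Pl, T.epsLoc θ π v = 1 ∨ T.epsLoc θ π v = -1) ∧ {v : T.Pl | T.epsLoc θ π v ≠ 1}.Finite

/-- **§6, `ε_π = ∏_v ε_{π_v}`** (reissue p. 47 l. 8; «the local factors depend upon a number of choices but `ε_π` itself is well-defined when the local
choices are made to depend in a consistent manner on global data, and this was done», ll. 9–10): the finite product `∏ᶠ v, ε_{π_v}` (Mathlib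
`finprod`; well defined by `epsLoc_spec`).  In the three-tori case this is print's `ε_{i,π} = ∏_v ε_{i,π_v}` for `θ = θ_i` (p. 47 l. 22).
[cite: LabesseLanglands1979, §6 (reissue p. 47)] -/
def eps (θ : T.Ch) (π : T.Rep) : ℤ := ∏ᶠ v : T.Pl, T.epsLoc θ π v

/-- **§6, «Finally set `n(π) = m(π) − ¼ ε_π e(π) µ(T′)`»** (reissue p. 47 ll. 12–14), the type-(a) formula, for `π ∈ Π(θ)`, `T′ = torusOf θ`.
[cite: LabesseLanglands1979, §6 (reissue p. 47)] -/
def nOneTorus (θ : T.Ch) (π : T.Rep) : ℚ :=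
  (T.m π : ℚ) - (1 / 4 : ℚ) * (T.eps θ π : ℚ) * (T.eNum (T.torusOf θ) π : ℚ) * (T.mu (T.torusOf θ) : ℚ)

/-! ### p. 47: the three-tori case -/

/-- **§6, «Then we introduce `n(π) = m(π) − ¼ Σ_{i=1}^{3} ε_{i,π} e_i(π) µ(T_i)`»** (reissue p. 47 ll. 23–30), for `π` lying in `Π(θ_i)`, `θ_i` a
character of `T_i`, `i = 1, 2, 3` («three distinct quadratic extensions `L₁, L₂, L₃` with associated Cartan subgroups `T_i` satisfying
`[E(T_i∕A) : Im E(T_i∕F)] = 2` and characters `θ_i` of `T_i` with `π ∈ Π(θ_i)`», ll. 15–19). [cite: LabesseLanglands1979, §6 (reissue p. 47)] -/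
def nThreeTori (θ : Fin 3 → T.Ch) (π : T.Rep) : ℚ :=
  (T.m π : ℚ) - (1 / 4 : ℚ) * ∑ i : Fin 3, (T.eps (θ i) π : ℚ) * (T.eNum (T.torusOf (θ i)) π : ℚ) * (T.mu (T.torusOf (θ i)) : ℚ)

/-- **§6, the definition of `n(π)`** (reissue pp. 46–47), the dictionary's `n` IS the printed number: (i) «If `π` belongs to no `Π(θ)` with
`[E(T′∕A) : Im E(T′∕F)] = 2` we set `n(π) = m(π)`» (p. 46 ll. 92–95); (ii) for `π` of type (a), `π ∈ Π(θ)`: `n(π) = m(π) − ¼ ε_π e(π) µ(T′)` (p. 47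
l. 13; independent of the choice of `θ` by `typeA_onlyStConj`, `typeA_signsAgree`); (iii) for `π` of type (b) — «If `π` is of type (b) [reissue:
«(c)», ERRATUM, module docstring CAVEAT (ii)] there are three distinct quadratic extensions `L₁, L₂, L₃` with associated Cartan subgroups `T_i` … and
characters `θ_i` of `T_i` with `π ∈ Π(θ_i)` … Then we introduce `n(π) = m(π) − ¼ Σ_{i=1}^{3} ε_{i,π} e_i(π) µ(T_i)`» (p. 47 ll. 15–30; Prop. 6.8 p. 56) —
such a triple `θ` of characters of three distinct Cartan subgroups EXISTS, and the formula holds for every such triple.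
[cite: LabesseLanglands1979, §6 (reissue pp. 46–47)] -/
def nSpec : Prop :=
  (∀ π : T.Rep, T.InNoPacket π → T.n π = T.m π) ∧
    (∀ (π : T.Rep) (θ : T.Ch), T.inPacket π θ → T.IsTypeA θ → T.n π = T.nOneTorus θ π) ∧
      ∀ π : T.Rep, T.IsRepTypeB π →
        (∃ θ : Fin 3 → T.Ch, Function.Injective (fun i => T.torusOf (θ i)) ∧ ∀ i, T.inPacket π (θ i)) ∧
          ∀ θ : Fin 3 → T.Ch, Function.Injective (fun i => T.torusOf (θ i)) → (∀ i, T.inPacket π (θ i)) →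
            T.n π = T.nThreeTori θ π

/-- **§6, «a curious property of the triple `ε_{1,π}, ε_{2,π}, ε_{3,π}`»** (reissue p. 47 ll. 32–44): in the three-tori case, with the local sets `Π^±(θ^i_v)`
defined from the `T_i`, `γ⁰_i` of §2, «`ε_{1,π_v} ε_{2,π_v} = ε_{3,π_v}` and `ε_{1,π} ε_{2,π} = ε_{3,π}`» (the numbering of the `θ_i` is print's, p. 47
ll. 15–22; here: for the triple in print's order). [cite: LabesseLanglands1979, §6 (reissue p. 47)] -/
def eps_triple (θ : Fin 3 → T.Ch) (π : T.Rep) : Prop :=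
  (∀ v : T.Pl, T.epsLoc (θ 0) π v * T.epsLoc (θ 1) π v = T.epsLoc (θ 2) π v) ∧ T.eps (θ 0) π * T.eps (θ 1) π = T.eps (θ 2) π

/-- **§6, «The distribution `f → Σ_π n(π) trace π(f)` is stable.»** (reissue p. 47 ll. 45–53).  β-guard: stated for the `∑'` together with the
summability of the series on `B`. [cite: LabesseLanglands1979, §6 (reissue p. 47)] -/
def stable_nTrace : Prop :=
  (∀ f ∈ T.B, Summable fun π : T.Rep => (T.n π : ℂ) * T.tr π f) ∧ T.IsStable fun f => ∑' π : T.Rep, (T.n π : ℂ) * T.tr π f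

/-! ### p. 48: LEMMA 6.1 and the displayed objects of its proof -/

/-- **LEMMA 6.1** (reissue p. 48 ll. 6–9; journal p. 768): «If `g ∈ G̃(A)` define `π^g` by `π^g : h → π(g h g⁻¹)`.  Then `n(π^g) = n(π)`.»  MULTIPLICITY
DRESS: `π^g = T.conj g π` (concrete model `conjRep`∕`conjRepNormal`).  The printed proof (pp. 48–49) runs through `lTraceVanishes`, `eq_6_1`,
`XMinusEmpty` below and the Hilbert-space argument typed and PROVED in the tree as ★ `Literature.NumberTheory.Automorphic.WeightedHilbertSchmidtVanishing`
(★ `weightedHilbertSchmidtVanishing_holds`). [cite: LabesseLanglands1979, Lemma 6.1 (reissue p. 48; journal p. 768)] -/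
def LabesseLanglands1979_6_1_conjInvariance : Prop :=
  ∀ (g : Gt) (π : T.Rep), T.n (T.conj g π) = T.n π

/-- **Proof of LEMMA 6.1, «Set `l(π) = n(π^g) − n(π)`»** (reissue p. 48 l. 12). [cite: LabesseLanglands1979, Lemma 6.1 (proof) (reissue p. 48; journal p. 768)] -/
def l (g : Gt) (π : T.Rep) : ℚ := T.n (T.conj g π) - T.n π

variable [Group G] [MeasurableSpace G]

/-- **Proof of LEMMA 6.1, «`B` is closed under `f → f^*` with `f^*(g) = f̄(g⁻¹)` and under the obvious convolution product»** (reissue p. 48 ll. 13–17):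
for the dictionary's `B ≤ (G → ℂ)`, closure under the tree's ★ `mulStar` (`f^*(g) = conj f(g⁻¹)`) and ★ `mulConv ν` (`(f₁ ⋆ f₂)(g) = ∫ f₁(u) f₂(u⁻¹ g) dν(u)`,
`ν` the Haar measure on `G`).  (Consumers: ★ `Rogawski1990.ArchTestKc.mulStar`, ★ `ArchTestKcConvolution` are this clause at the archimedean test
algebra of `U(2,1)`.) [cite: LabesseLanglands1979, Lemma 6.1 (proof) (reissue p. 48; journal p. 768)] -/
def IsStarConvClosed (ν : Measure G) : Prop :=
  (∀ f ∈ T.B, mulStar f ∈ T.B) ∧ ∀ f₁ ∈ T.B, ∀ f₂ ∈ T.B, mulConv ν f₁ f₂ ∈ T.B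

omit [Group G] [MeasurableSpace G] in
/-- **Proof of LEMMA 6.1, «Moreover, for `f` in `B`, `Σ l(π) trace π(f)` is absolutely convergent and equal to `0`»** (reissue p. 48 ll. 17–23):
absolute convergence = summability of the norms (β-guard: recorded, so that the vanishing of the `∑'` is not a junk value).
[cite: LabesseLanglands1979, Lemma 6.1 (proof) (reissue p. 48; journal p. 768)] -/
def lTraceVanishes (g : Gt) : Prop :=
  ∀ f ∈ T.B, Summable (fun π : T.Rep => ‖((T.l g π : ℚ) : ℂ) * T.tr π f‖) ∧ ∑' π : T.Rep, ((T.l g π : ℚ) : ℂ) * T.tr π f = 0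

omit [Group G] [MeasurableSpace G] in
/-- **Proof of LEMMA 6.1, `X⁺`** (reissue p. 48 l. 37): «Let `X⁺` be the set of `π` with `l(π) > 0`». [cite: LabesseLanglands1979, Lemma 6.1 (proof) (reissue p. 48; journal p. 768)] -/
def XPlus (g : Gt) : Set T.Rep := {π | 0 < T.l g π}

omit [Group G] [MeasurableSpace G] in
/-- **Proof of LEMMA 6.1, `X⁻`** (reissue p. 48 l. 37): «… and `X⁻` the set with `l(π) < 0`». [cite: LabesseLanglands1979, Lemma 6.1 (proof) (reissue p. 48; journal p. 768)] -/
def XMinus (g : Gt) : Set T.Rep := {π | T.l g π < 0}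

/-- **Proof of LEMMA 6.1, display (6.1)** (reissue p. 48 ll. 23–35): «In particular (6.1) `Σ_{l(π)>0} l(π) trace π(f f^*) = Σ_{l(π)<0} −l(π) trace π(f f^*)`»
for `f ∈ B`, `f f^*` the convolution `f ⋆ f^*` (★ `mulConv ν f (mulStar f)`).  β-guard: both sides recorded with their summability (print: from the
absolute convergence of `Σ l(π) trace π(f f^*)`). [cite: LabesseLanglands1979, Lemma 6.1 (proof) (6.1) (reissue p. 48; journal p. 768)] -/
def eq_6_1 (ν : Measure G) (g : Gt) : Prop :=
  ∀ f ∈ T.B,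
    Summable (fun π : T.XPlus g => ((T.l g π : ℚ) : ℂ) * T.tr π (mulConv ν f (mulStar f))) ∧
      Summable (fun π : T.XMinus g => ((-T.l g π : ℚ) : ℂ) * T.tr π (mulConv ν f (mulStar f))) ∧
        ∑' π : T.XPlus g, ((T.l g π : ℚ) : ℂ) * T.tr π (mulConv ν f (mulStar f)) =
          ∑' π : T.XMinus g, ((-T.l g π : ℚ) : ℂ) * T.tr π (mulConv ν f (mulStar f))

omit [Group G] [MeasurableSpace G] in
/-- **Proof of LEMMA 6.1, «All we need do is show that `X⁻` is empty.»** (reissue p. 48 ll. 37–39; the contradiction pp. 48–49 = ★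
`WeightedHilbertSchmidtVanishing`: unit eigenvector `x₀` of `π₀(f f^*)`, `δ = max_{π∈X⁺} λ(π)`, Hilbert–Schmidt `f₁` «as on p. 498 of [6]»).
[cite: LabesseLanglands1979, Lemma 6.1 (proof) (reissue pp. 48–49; journal pp. 768–769)] -/
def XMinusEmpty (g : Gt) : Prop := T.XMinus g = ∅

end MultiplicityTable

/-! ## ED. 3: LEMMA 6.2 – PROPOSITION 6.8 (reissue pp. 49–56) and the objects they are stated in

The numbered items of §6 after LEMMA 6.1.  They live on THREE levels of groups (module docstring, CAVEAT (iv)): «`G̃(𝐀)`» (`Gt`) ⊇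
«`G′ = {g ∈ G̃(𝐀_F) | det g ∈ A}`» (the dictionary parameter `G`; its representations are `Rep`, carrying `m`, `n`) ⊇ «`G(𝐀)`», `G = SL(2)` or its
twisted form (§2).  The data the seven items need beyond ED. 1–2's `MultiplicityTable` are carried by the extension `QTable`; as before every printed
assertion is a PREDICATE on the dictionary (print's theorem = the predicate holds for the genuine data of §§5–6; nothing is claimed for all data, no debt
is created), every printed object is a genuine `def` over it, and the closed identities are THEOREMS: inside PROPOSITIONS 6.7–6.8 the displayed
formula for `m(π)` from the one for `n(π)`, the definition of `n(π)` and the printed «observation» (`LabesseLanglands1979_6_7_mFormula`,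
`…_6_8_mFormula`); the equality of the two bracket expressions of COROLLARY 6.3 and «this is the index of Corollary 6.3» for `d(π)` (p. 54 l. 16)
(`corIndex'_eq_corIndex`, `corIndex_eq_d`, from the subgroup-index identity `relIndex_sup_inf_sup`). -/

universe x

/-- **Dictionary extension for LEMMA 6.2 – PROPOSITION 6.8** (reissue pp. 49–56).  New parameters: the group structure of `Gt` = «`G̃(𝐀)`» and the
idèle group `IF` = «`I_F = GL(1, 𝐀_F)`» (§5 p. 30), a commutative group.  Fields (all DATA; the printed relations between them are the predicates
below):
* `GtF` — «`G̃(F)`» `≤ G̃(𝐀)` (Lemma 6.2); `det` — «`det`» on `G̃(𝐀)` (Cor. 6.3 «`A(π) = {det g | g ∈ G(π)}`»); `Fx` — «`F^×`» `≤ I_F`; `A` — the closed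
  subgroup «`A = ∏_v A_v`» of `I_F` with «`G′ = {g ∈ G̃(𝐀_F) | det g ∈ A}`», «`A_F = A ∩ F^×`» (§5 p. 30 ll. 5–11);
* `RepT` — the representations «`π̃ = ⊗ π̃_v` of `G̃(𝐀)`» (p. 49 l. 11; irreducible admissible, up to equivalence); `RepS` — the irreducible
  representations `π` of «`G(𝐀)`» occurring as «one of the irreducible components of its restriction to `G(𝐀)`» (p. 49 ll. 12–14); `toT π` — such a
  `π̃` for `π` (print reads `G(π) = G(π̃)`, `X(π) = X(π̃)`, `q(π) = q(π̃)` through it, p. 49 ll. 14–20); `comp π′` — «one of the irreducible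
  components of the restriction of `π′` to `G(𝐀)`» for a representation `π′` of `G′` (`π′ ∈ Rep`; Cor. 6.3 p. 52 l. 16, p. 54 l. 21 «if `π′` is a
  representation of `G′` and `π` a component of its restriction to `G(𝐀)` we set `d(π′) = d(π)`»);
* `conjS h π` — «`ʰπ : g → π(h⁻¹ g h)`», `h ∈ G̃(𝐀)` (p. 49 l. 15; `= π^{h⁻¹}` in LEMMA 6.1's notation), as a homomorphism `G̃(𝐀) → Perm(RepS)`,
  so that «`G(π)`, the set of all `h` in `G̃(𝐀)` for which `ʰπ` is equivalent to `π`» is a subgroup by construction (`GPi`);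
* `mS π` — «`m(π)`» of LEMMA 6.2, i.e. for «`G′ = G(𝐀)`»: the multiplicity of the representation `π` of `G(𝐀)` in the cusp forms on `G(F)\G(𝐀)`
  (p. 51 l. 14 «the `m(π)` for cuspidal automorphic forms for `G(𝐀)`»); `IsInfDim π` — «`π` is infinite-dimensional»; `centralChi π` —
  «`π(z) = χ⁻¹(z) I`, `z ∈ ₀Z′`» (the hypotheses of LEMMA 6.2; `₀Z′`, `χ` as in §5 p. 30);
* `Char` — the characters «`ω` of `I_F`» (p. 49 l. 16), a subgroup of `I_F →* ℂˣ`; `twist ω π̃` — «`ω ⊗ π̃`»; `IsAutCusp π̃` — «`ω ⊗ π̃` is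
  automorphic and cuspidal» (p. 49 l. 18) = «a constituent of the space of cusp forms of `G̃(𝐀)`» (Prop. 6.5);
* `Quad` — the quadratic extensions `L` of `F`; `quadChar L` — the «non-trivial character `ω` of `F^×\I_F` of order `2`» by which «`L` is the quadratic
  extension of `F` defined by `ω`» (Prop. 6.5; Cor. 6.6 «the quadratic character of `F^×\I_F` defined by `L`», p. 53 l. 8); `HeckeCh L` — the
  characters «`θ` of `L^×\I_L`»; `factorsThroughNorm L θ` — «`θ` factors through the norm» (Cor. 6.6); `piTheta L θ` — «`π(θ)`», the representation
  of `G̃(𝐀)` attached to `θ` (§3; Prop. 6.5, Cor. 6.6).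
[cite: LabesseLanglands1979, §6 (reissue pp. 49–56)] -/
structure QTable (G : Type u) (Gt : Type v) [Group Gt] (IF : Type x) [CommGroup IF]
    extends MultiplicityTable.{u, v, w} G Gt where
  /-- `G̃(F) ≤ G̃(𝐀)` -/
  GtF : Subgroup Gt
  /-- `det : G̃(𝐀) → I_F` -/
  det : Gt →* IF
  /-- `F^× ≤ I_F` -/
  Fx : Subgroup IF
  /-- the subgroup `A ≤ I_F` with `G′ = {det ∈ A}` -/
  A : Subgroup IF
  /-- the representations `π̃` of `G̃(𝐀)` -/
  RepT : Type w
  /-- the irreducible representations `π` of `G(𝐀)` (components of restrictions) -/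
  RepS : Type w
  /-- `π ↦ π̃`, a representation of `G̃(𝐀)` of whose restriction `π` is a component -/
  toT : RepS → RepT
  /-- `π′ ↦ π`, a component of the restriction of `π′ ∈ Rep` to `G(𝐀)` -/
  comp : Rep → RepS
  /-- `h ↦ (π ↦ ʰπ)`, `ʰπ(g) = π(h⁻¹ g h)` -/
  conjS : Gt →* Equiv.Perm RepS
  /-- `m(π)` for `G′ = G(𝐀)` (Lemma 6.2) -/
  mS : RepS → ℕ
  /-- «`π` is infinite-dimensional» -/
  IsInfDim : RepS → Prop
  /-- «`π(z) = χ⁻¹(z) I`, `z ∈ ₀Z′`» -/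
  centralChi : RepS → Prop
  /-- the characters `ω` of `I_F` -/
  Char : Subgroup (IF →* ℂˣ)
  /-- `ω ⊗ π̃` -/
  twist : (IF →* ℂˣ) → RepT → RepT
  /-- «automorphic and cuspidal» -/
  IsAutCusp : RepT → Prop
  /-- the quadratic extensions `L` of `F` -/
  Quad : Type w
  /-- the order-two character `ω` of `F^×\I_F` defining `L` -/
  quadChar : Quad → (IF →* ℂˣ)
  /-- the characters `θ` of `L^×\I_L` -/
  HeckeCh : Quad → Type w
  /-- «`θ` factors through the norm» -/
  factorsThroughNorm : (L : Quad) → HeckeCh L → Prop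
  /-- `π(θ)` -/
  piTheta : (L : Quad) → HeckeCh L → RepT

namespace QTable

/-! ### An index identity for subgroups of a commutative group (used for COROLLARY 6.3 ∕ `d(π)`, p. 54 l. 16) -/

section IndexIdentity

variable {M : Type*} [CommGroup M] (X Y Z : Subgroup M)

/-- (Private helper for `relIndex_sup_inf_sup`.)  `X Y ∩ Z Y = (X ∩ Y Z) · ((X ∩ Z) Y)` for subgroups of a commutative group. [folklore] -/
private theorem sup_inf_sup_eq : (X ⊔ Y) ⊓ (Z ⊔ Y) = (X ⊓ (Y ⊔ Z)) ⊔ ((X ⊓ Z) ⊔ Y) := by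
  apply le_antisymm
  · intro w hw
    obtain ⟨hw1, hw2⟩ := Subgroup.mem_inf.mp hw
    obtain ⟨x, hx, y, hy, rfl⟩ := Subgroup.mem_sup.mp hw1
    obtain ⟨z, hz, y', hy', hzy⟩ := Subgroup.mem_sup.mp hw2
    have hx' : x ∈ Y ⊔ Z := by
      have hxe : x = z * y' * y⁻¹ := by rw [hzy, mul_inv_cancel_right]
      rw [hxe]
      exact Subgroup.mul_mem _ (Subgroup.mul_mem _ (Subgroup.mem_sup_right hz) (Subgroup.mem_sup_left hy'))
        (Subgroup.mem_sup_left (Y.inv_mem hy))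
    exact Subgroup.mul_mem_sup (Subgroup.mem_inf.mpr ⟨hx, hx'⟩) (Subgroup.mem_sup_right hy)
  · refine sup_le (le_inf ?_ ?_) (sup_le (le_inf ?_ ?_) (le_inf le_sup_right le_sup_right))
    · exact inf_le_left.trans le_sup_left
    · exact inf_le_right.trans (sup_le le_sup_right le_sup_left)
    · exact inf_le_left.trans le_sup_left
    · exact inf_le_right.trans le_sup_left

/-- (Private helper for `relIndex_sup_inf_sup`.)  `(X ∩ Z) Y ∩ (X ∩ Y Z) = (X ∩ Y)(X ∩ Z)` for subgroups of a commutative group. [folklore] -/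
private theorem sup_inf_inf_sup_eq : ((X ⊓ Z) ⊔ Y) ⊓ (X ⊓ (Y ⊔ Z)) = (X ⊓ Y) ⊔ (X ⊓ Z) := by
  apply le_antisymm
  · intro w hw
    obtain ⟨hw1, hw2⟩ := Subgroup.mem_inf.mp hw
    obtain ⟨t, ht, y, hy, rfl⟩ := Subgroup.mem_sup.mp hw1
    have hX : t * y ∈ X := (Subgroup.mem_inf.mp hw2).1
    have htX : t ∈ X := (Subgroup.mem_inf.mp ht).1
    have hyX : y ∈ X := by
      have := X.mul_mem (X.inv_mem htX) hX
      rwa [inv_mul_cancel_left] at this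
    rw [sup_comm]
    exact Subgroup.mul_mem_sup ht (Subgroup.mem_inf.mpr ⟨hyX, hy⟩)
  · refine sup_le (le_inf ?_ (le_inf inf_le_left ?_)) (le_inf le_sup_left (le_inf inf_le_left ?_))
    · exact inf_le_right.trans le_sup_right
    · exact inf_le_right.trans le_sup_left
    · exact inf_le_right.trans le_sup_right

/-- **The index identity behind «This is the index of Corollary 6.3»** (reissue p. 54 l. 16): for subgroups `X, Y, Z` of a commutative group,
`[X Y ∩ Z Y : (X ∩ Z) Y] = [X ∩ Y Z : (X ∩ Y)(X ∩ Z)]` (both quotients are `(X ∩ Y Z) ∕ (X ∩ Y)(X ∩ Z)`: second isomorphism theorem with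
`X Y ∩ Z Y = (X ∩ Y Z) · (X ∩ Z) Y` and `(X ∩ Y Z) ∩ (X ∩ Z) Y = (X ∩ Y)(X ∩ Z)`; Mathlib `Subgroup.relIndex H K` = the index of `H ∩ K` in `K`).
[cite: LabesseLanglands1979, §6 (reissue p. 54)] -/
theorem relIndex_sup_inf_sup (X Y Z : Subgroup M) :
    ((X ⊓ Z) ⊔ Y).relIndex ((X ⊔ Y) ⊓ (Z ⊔ Y)) = ((X ⊓ Y) ⊔ (X ⊓ Z)).relIndex (X ⊓ (Y ⊔ Z)) := by
  rw [sup_inf_sup_eq, Subgroup.relIndex_sup_right, ← Subgroup.inf_relIndex_right, sup_inf_inf_sup_eq]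

/-- (Private helper.)  The symmetric form `[X Z ∩ Y Z ∕… ]`: `[(X ∩ Z)(Y ∩ Z) : Z ∩ X Y]`-index equals the index of `relIndex_sup_inf_sup`
(full `S₃`-symmetry of that number in `X, Y, Z`). [folklore] -/
private theorem relIndex_sup_inf_sup' :
    ((X ⊓ Z) ⊔ (Y ⊓ Z)).relIndex (Z ⊓ (X ⊔ Y)) = ((X ⊓ Z) ⊔ Y).relIndex ((X ⊔ Y) ⊓ (Z ⊔ Y)) := by
  calc ((X ⊓ Z) ⊔ (Y ⊓ Z)).relIndex (Z ⊓ (X ⊔ Y))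
      = ((Z ⊓ Y) ⊔ (Z ⊓ X)).relIndex (Z ⊓ (Y ⊔ X)) := by
        rw [inf_comm X Z, inf_comm Y Z, sup_comm (Z ⊓ X) (Z ⊓ Y), sup_comm X Y]
    _ = ((Z ⊓ X) ⊔ Y).relIndex ((Z ⊔ Y) ⊓ (X ⊔ Y)) := (relIndex_sup_inf_sup Z Y X).symm
    _ = ((X ⊓ Z) ⊔ Y).relIndex ((X ⊔ Y) ⊓ (Z ⊔ Y)) := by rw [inf_comm Z X, inf_comm (Z ⊔ Y) (X ⊔ Y)]

/-- (Private helper.)  `relIndex_sup_inf_sup` with the two factors of its right-hand side commuted. [folklore] -/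
private theorem relIndex_sup_inf_sup'' :
    ((X ⊓ Z) ⊔ Y).relIndex ((X ⊔ Y) ⊓ (Z ⊔ Y)) = ((X ⊓ Z) ⊔ (X ⊓ Y)).relIndex (X ⊓ (Y ⊔ Z)) := by
  rw [relIndex_sup_inf_sup, sup_comm (X ⊓ Y) (X ⊓ Z)]

end IndexIdentity

variable {G : Type u} {Gt : Type v} [Group Gt] {IF : Type x} [CommGroup IF] (T : QTable.{u, v, w, x} G Gt IF)

/-! ### p. 49: `G(π)`, `X(π̃)`, `Y`, `Y(π̃)`, `q(π)` -/

/-- «`A_F = A ∩ F^×`» (§5, reissue p. 30 l. 7). [cite: LabesseLanglands1979, §5 (reissue p. 30)] -/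
def AF : Subgroup IF := T.A ⊓ T.Fx

/-- **«Let `G(π)` or `G(π̃)` be the set of all `h` in `G̃(𝐀)` for which `ʰπ : g → π(h⁻¹ g h)` is equivalent to `π`»** (reissue p. 49 ll. 14–16): the
stabiliser of `π ∈ RepS` under `conjS`, a subgroup of `G̃(𝐀)`. [cite: LabesseLanglands1979, §6 (reissue p. 49)] -/
def GPi (π : T.RepS) : Subgroup Gt := (MulAction.stabilizer (Equiv.Perm T.RepS) π).comap T.conjS

/-- `h ∈ G(π) ↔ ʰπ = π` (unfolding). [cite: LabesseLanglands1979, §6 (reissue p. 49)] -/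
theorem mem_GPi_iff (π : T.RepS) (h : Gt) : h ∈ T.GPi π ↔ T.conjS h π = π := Iff.rfl

/-- **«Let `A(π′) = A(π) = {det g | g ∈ G(π)}`»** (COROLLARY 6.3, reissue p. 52 l. 16; p. 54): the image of `G(π)` under `det`, a subgroup of `I_F`.
[cite: LabesseLanglands1979, Corollary 6.3 (reissue p. 52)] -/
def APi (π : T.RepS) : Subgroup IF := (T.GPi π).map T.det

/-- **«Let `X(π) = X(π̃)` be the set of all characters `ω` of `I_F` for which `π̃ ≃ ω ⊗ π̃`»** (reissue p. 49 l. 16).  (Print adds: «`X(π̃)` consists of the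
characters trivial on `{det h | h ∈ G(π̃)}`», l. 17.) [cite: LabesseLanglands1979, §6 (reissue p. 49)] -/
def XChars (ρ : T.RepT) : Set (IF →* ℂˣ) := {ω | ω ∈ T.Char ∧ T.twist ω ρ = ρ}

/-- **«Let `Y` be the set of characters of `F^×\I_F`»** (reissue p. 49 l. 17): the characters of `I_F` trivial on `F^×`, a subgroup.
[cite: LabesseLanglands1979, §6 (reissue p. 49)] -/
def Y : Subgroup (IF →* ℂˣ) where
  carrier := {ω | ω ∈ T.Char ∧ ∀ a ∈ T.Fx, ω a = 1}
  one_mem' := ⟨T.Char.one_mem, fun _ _ => rfl⟩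
  mul_mem' := by
    rintro ω ω' ⟨hω, h1⟩ ⟨hω', h1'⟩
    exact ⟨T.Char.mul_mem hω hω', fun a ha => by simp [h1 a ha, h1' a ha]⟩
  inv_mem' := by
    rintro ω ⟨hω, h1⟩
    exact ⟨T.Char.inv_mem hω, fun a ha => by simp [h1 a ha]⟩

/-- `ω ∈ Y ↔ ω` is a character of `I_F` trivial on `F^×` (unfolding). [cite: LabesseLanglands1979, §6 (reissue p. 49)] -/
theorem mem_Y_iff (ω : IF →* ℂˣ) : ω ∈ T.Y ↔ ω ∈ T.Char ∧ ∀ a ∈ T.Fx, ω a = 1 := Iff.rfl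

/-- **«… and `Y(π̃)` the set of all characters `ω` of `I_F` for which `ω ⊗ π̃` is automorphic and cuspidal»** (reissue p. 49 ll. 17–18).
[cite: LabesseLanglands1979, §6 (reissue p. 49)] -/
def YPi (ρ : T.RepT) : Set (IF →* ℂˣ) := {ω | ω ∈ T.Char ∧ T.IsAutCusp (T.twist ω ρ)}

/-- Print's «`Y X(π̃)`» (reissue p. 49 l. 20): the subgroup of characters generated by `Y` and `X(π̃)`. [cite: LabesseLanglands1979, §6 (reissue p. 49)] -/
def YX (ρ : T.RepT) : Subgroup (IF →* ℂˣ) := Subgroup.closure ((T.Y : Set (IF →* ℂˣ)) ∪ T.XChars ρ)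

/-- **«Let `q(π) = q(π̃) = [Y(π̃)/Y X(π̃)]`. It will be seen in a moment that this index is finite; it is likely always to be `0` or `1` …»** (reissue
p. 49 ll. 20–23): the number of classes of `Y(π̃)` modulo `Y X(π̃)` (`Set.ncard` of the image of `Y(π̃)` in the quotient of the character group by
`Y X(π̃)`; β-guard: `ncard` is `0` on an infinite set — LEMMA 6.2 records the finiteness print asserts). [cite: LabesseLanglands1979, §6 (reissue p. 49)] -/
def q (ρ : T.RepT) : ℕ := (((↑) : (IF →* ℂˣ) → (IF →* ℂˣ) ⧸ T.YX ρ) '' T.YPi ρ).ncard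

/-! ### p. 49: LEMMA 6.2 -/

/-- **LEMMA 6.2** (reissue p. 49 ll. 24–36): «Suppose `G′ = G(𝐀)` and `π` is infinite-dimensional with `π(z) = χ⁻¹(z) I`, `z ∈ ₀Z′`.  Then
`q(π) = Σ_{G̃(F) G(π) \ G̃(𝐀)} m(ʰπ)`.  It follows easily from this equation that `q(π)` is finite.»  MULTIPLICITY DRESS: `π ∈ RepS` (a representation of
`G(𝐀)` = the case `G′ = G(𝐀)`, whose multiplicities are `mS`), `q(π) = q(π̃)` with `π̃ = toT π`; the sum runs over print's index set, the double-coset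
space `G̃(F)\G̃(𝐀)/G(π)` (Mathlib `DoubleCoset.Quotient`), which is finite, each class `c` contributing `m(ʰπ)` for its representative
`h = Quotient.out c` (print's notation presupposes that `m(ʰπ)` depends on the class of `h` only); β-guard: `finsum` over a type recorded `Finite`.
[cite: LabesseLanglands1979, Lemma 6.2 (reissue p. 49)] -/
def LabesseLanglands1979_6_2_qFormula : Prop :=
  ∀ π : T.RepS, T.IsInfDim π → T.centralChi π →
    Finite (DoubleCoset.Quotient (T.GtF : Set Gt) (T.GPi π : Set Gt)) ∧
      T.q (T.toT π) = ∑ᶠ c : DoubleCoset.Quotient (T.GtF : Set Gt) (T.GPi π : Set Gt), T.mS (T.conjS (Quotient.out c) π)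

/-! ### pp. 52–54: COROLLARY 6.3, `d(π)`, PROPOSITIONS 6.4, 6.5, COROLLARY 6.6 -/

/-- **COROLLARY 6.3, the index «`[A A(π) ∩ F^× A(π) : A_F A(π)]`»** (reissue p. 52 l. 18), for `π ∈ RepS` (subgroups of the commutative group `I_F`;
Mathlib `Subgroup.relIndex H K` = the index of `H ∩ K` in `K`, here with `H ≤ K`). [cite: LabesseLanglands1979, Corollary 6.3 (reissue p. 52)] -/
def corIndex (π : T.RepS) : ℕ := (T.AF ⊔ T.APi π).relIndex ((T.A ⊔ T.APi π) ⊓ (T.Fx ⊔ T.APi π))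

/-- **COROLLARY 6.3, the second printed form «`[F^× ∩ A A(π) : A_F A(π)_F]`»** of the same index (reissue p. 52 l. 18; `A(π)_F = A(π) ∩ F^×`).
[cite: LabesseLanglands1979, Corollary 6.3 (reissue p. 52)] -/
def corIndex' (π : T.RepS) : ℕ := (T.AF ⊔ (T.APi π ⊓ T.Fx)).relIndex (T.Fx ⊓ (T.A ⊔ T.APi π))

/-- **COROLLARY 6.3** (reissue p. 52 ll. 14–18): «Suppose `π′` is a cuspidal automorphic representation of `G′` and `π` one of the irreducible components of
the restriction of `π′` to `G(𝐀)`.  Let `A(π′) = A(π) = {det g | g ∈ G(π)}`.  If `q(π)` is `1` then the multiplicity with which `π′` occurs in the space of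
automorphic forms on `G′_F\G′` is `[A A(π) ∩ F^× A(π) : A_F A(π)] = [F^× ∩ A A(π) : A_F A(π)_F]`.»  MULTIPLICITY DRESS: `π′ ∈ Rep` with `m(π′) ≥ 1`
(«cuspidal automorphic»: `m` is the multiplicity in the cusp forms `r`, p. 46), `π = comp π′`, `q(π) = q(toT π)`; the multiplicity is `m(π′)` and the
index is `corIndex` (first printed form; the second printed form `corIndex'` equals it — THEOREM `corIndex'_eq_corIndex` — and p. 54 l. 16
identifies it with `d(π)` — THEOREM `corIndex_eq_d`). [cite: LabesseLanglands1979, Corollary 6.3 (reissue p. 52)] -/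
def LabesseLanglands1979_6_3_multiplicity : Prop :=
  ∀ π' : T.Rep, 0 < T.m π' → T.q (T.toT (T.comp π')) = 1 → T.m π' = T.corIndex (T.comp π')

/-- **`d(π)`** (reissue p. 54 ll. 13–21): «Thus the number of global equivalence classes within one local equivalence class is
`[A F^× ∩ A(π) F^× : F^×(A ∩ A(π))] = [A ∩ A(π) F^× : A_F (A ∩ A(π))]`.  This is the index of Corollary 6.3.  It depends only on the
L-indistinguishability class to which `π` belongs … We denote it by `d(π)`.»  Typed by the second printed expression, for `π ∈ RepS`.
[cite: LabesseLanglands1979, §6 (reissue p. 54)] -/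
def d (π : T.RepS) : ℕ := (T.AF ⊔ (T.A ⊓ T.APi π)).relIndex (T.A ⊓ (T.APi π ⊔ T.Fx))

/-- **`d(π′) = d(π)`** (reissue p. 54 ll. 20–21): «More generally if `π′` is a representation of `G′` and `π` a component of its restriction to `G(𝐀)` we set
`d(π′) = d(π)`» — for `π′ ∈ Rep`, through the dictionary's component `comp π′`. [cite: LabesseLanglands1979, §6 (reissue p. 54)] -/
def dRep (π' : T.Rep) : ℕ := T.d (T.comp π')

/-- **COROLLARY 6.3, «`[A A(π) ∩ F^× A(π) : A_F A(π)] = [F^× ∩ A A(π) : A_F A(π)_F]`»** (reissue p. 52 l. 18): the two printed bracket expressions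
are equal — THEOREM (`relIndex_sup_inf_sup` with `{X, Y, Z} = {A, A(π), F^×}`). [cite: LabesseLanglands1979, Corollary 6.3 (reissue p. 52)] -/
theorem corIndex'_eq_corIndex (π : T.RepS) : T.corIndex' π = T.corIndex π :=
  relIndex_sup_inf_sup' T.A (T.APi π) T.Fx

/-- **«This is the index of Corollary 6.3»** (reissue p. 54 l. 16): the index of COROLLARY 6.3 equals `d(π)` as defined by the display of p. 54 —
THEOREM (`relIndex_sup_inf_sup`). [cite: LabesseLanglands1979, §6 (reissue p. 54)] -/
theorem corIndex_eq_d (π : T.RepS) : T.corIndex π = T.d π :=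
  relIndex_sup_inf_sup'' T.A (T.APi π) T.Fx

/-- **PROPOSITION 6.4** (reissue p. 52 ll. 20–22): «Suppose `π` is a representation of `G′`.  If `m(π^g)` is not equal to `m(π)` for all `g ∈ G̃(𝐀)` there
is a `T′` with `[𝔈(T′/𝐀) : Im 𝔈(T′/F)] = 2` and a `θ` such that `π` belongs to `Π(θ)`.»  (Print's gloss: «If there were no such `T′` and `θ` then
`m(π^g)` would be `n(π^g)` for all `g`.»)  MULTIPLICITY DRESS: `π ∈ Rep`, `π^g = conj g π` (LEMMA 6.1), and the dictionary's `Ch` ranges exactly over the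
characters `θ` of the `T′` with `[𝔈(T′/𝐀) : Im 𝔈(T′/F)] = 2` (`Car`). [cite: LabesseLanglands1979, Proposition 6.4 (reissue p. 52)] -/
def LabesseLanglands1979_6_4_packetOfNonInvariant : Prop :=
  ∀ π : T.Rep, (∃ g : Gt, T.m (T.conj g π) ≠ T.m π) → ∃ θ : T.Ch, T.inPacket π θ

/-- **PROPOSITION 6.5** (reissue p. 52 ll. 23–28): «Suppose `ω` is a non-trivial character of `F^×\I_F` of order `2` and `π` is a constituent of the space of
cusp forms of `G̃(𝐀)`.  If `π ≃ ω ⊗ π` then there is a character `θ` of `L^×\I_L`, where `L` is the quadratic extension of `F` defined by `ω`, for which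
`π = π(θ)`.»  MULTIPLICITY DRESS: stated for the quadratic extension `L ∈ Quad` with its character `ω = quadChar L`, `π ∈ RepT` automorphic cuspidal.
[cite: LabesseLanglands1979, Proposition 6.5 (reissue p. 52)] -/
def LabesseLanglands1979_6_5_selfTwist : Prop :=
  ∀ (L : T.Quad) (ρ : T.RepT), T.IsAutCusp ρ → T.twist (T.quadChar L) ρ = ρ → ∃ θ : T.HeckeCh L, ρ = T.piTheta L θ

/-- **COROLLARY 6.6** (reissue p. 53 ll. 5–7): «Suppose `L` is a quadratic extension of `F`, `θ` a character of `L^×\I_L` which does not factor through the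
norm, and `π̃ = π(θ)`.  Then `q(π̃) = 1`.» [cite: LabesseLanglands1979, Corollary 6.6 (reissue p. 53)] -/
def LabesseLanglands1979_6_6_qOne : Prop :=
  ∀ (L : T.Quad) (θ : T.HeckeCh L), ¬ T.factorsThroughNorm L θ → T.q (T.piTheta L θ) = 1

/-! ### p. 56: PROPOSITIONS 6.7 and 6.8 -/

/-- **PROPOSITION 6.7, the «observation»** (reissue p. 56 ll. 27–29): «One need only observe that when `θ` is of type (a) `e(π) µ(T′) = 2 d(π)`» — for
`π ∈ Π(θ)`, `T′ = torusOf θ`. [cite: LabesseLanglands1979, Proposition 6.7 (reissue p. 56)] -/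
def typeA_eMu : Prop :=
  ∀ (π : T.Rep) (θ : T.Ch), T.inPacket π θ → T.IsTypeA θ → T.eNum (T.torusOf θ) π * T.mu (T.torusOf θ) = 2 * T.dRep π

/-- **PROPOSITION 6.7** (reissue p. 56 ll. 15–25): «Suppose `θ` is a character of `T′_F\T′` with `[𝔈(T′/𝐀) : Im 𝔈(T′/F)] = 2` and `π` in `Π(θ)` is of type (a).
Then `n(π) = d(π)/2` and `m(π) = (d(π)/2)(1 + ε_π)`.»  MULTIPLICITY DRESS: `π ∈ Rep`, `θ ∈ Ch` with `π ∈ Π(θ)` and `θ` of type (a) (p. 46 ll. 95–96: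
the type of `π` is the type of `θ`), `ε_π = eps θ π` (p. 47), `d(π) = dRep π` (p. 54). [cite: LabesseLanglands1979, Proposition 6.7 (reissue p. 56)] -/
def LabesseLanglands1979_6_7_typeA : Prop :=
  ∀ (π : T.Rep) (θ : T.Ch), T.inPacket π θ → T.IsTypeA θ →
    (T.n π : ℚ) = T.dRep π / 2 ∧ (T.m π : ℚ) = (T.dRep π : ℚ) / 2 * (1 + T.eps θ π)

/-- **PROPOSITION 6.8, the «observation»** (reissue p. 56 ll. 43–45): «When `θ` is of type (b) `e(π) µ(T′) = d(π)`» — for `π ∈ Π(θ)`, `T′ = torusOf θ`.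
[cite: LabesseLanglands1979, Proposition 6.8 (reissue p. 56)] -/
def typeB_eMu : Prop :=
  ∀ (π : T.Rep) (θ : T.Ch), T.inPacket π θ → T.IsTypeB θ → T.eNum (T.torusOf θ) π * T.mu (T.torusOf θ) = T.dRep π

/-- **PROPOSITION 6.8** (reissue p. 56 ll. 30–41): «Suppose `π` is of type (b) and lies in `Π(θ¹)`, `Π(θ²)`, `Π(θ³)`, where `θⁱ` is a character of `T′_i`
trivial on `T′_i ∩ G′_F` and `[𝔈(T′_i/𝐀) : Im 𝔈(T′_i/F)] = 2`.  Then `n(π) = d(π)/4` and `m(π) = (d(π)/4){1 + ε_{1,π} + ε_{2,π} + ε_{3,π}}`.»  MULTIPLICITY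
DRESS: as in `nSpec` (iii) — `π ∈ Rep` of type (b), a triple `θ` of characters (`Ch`: characters of `T′_F\T′`, `[𝔈(T′/𝐀) : Im 𝔈(T′/F)] = 2`) of three
distinct Cartan subgroups with `π ∈ Π(θ i)`; `ε_{i,π} = eps (θ i) π`. [cite: LabesseLanglands1979, Proposition 6.8 (reissue p. 56)] -/
def LabesseLanglands1979_6_8_typeB : Prop :=
  ∀ (π : T.Rep) (θ : Fin 3 → T.Ch), T.IsRepTypeB π → (Function.Injective fun i => T.torusOf (θ i)) → (∀ i, T.inPacket π (θ i)) →
    (T.n π : ℚ) = T.dRep π / 4 ∧ (T.m π : ℚ) = (T.dRep π : ℚ) / 4 * (1 + ∑ i : Fin 3, (T.eps (θ i) π : ℚ))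

/-! ### The closed identities inside PROPOSITIONS 6.7–6.8 (theorems) -/

/-- **PROPOSITION 6.7, second formula from the first** («One need only observe …», reissue p. 56): from the definition of `n(π)` for `π` of type (a)
(`nSpec` (ii): `n(π) = m(π) − ¼ ε_π e(π) µ(T′)`), the observation `e(π) µ(T′) = 2 d(π)` and `n(π) = d(π)/2`, the multiplicity is
`m(π) = (d(π)/2)(1 + ε_π)`. [cite: LabesseLanglands1979, Proposition 6.7 (reissue p. 56)] -/
theorem LabesseLanglands1979_6_7_mFormula (hn : T.nSpec) (he : T.typeA_eMu) {π : T.Rep} {θ : T.Ch} (hπ : T.inPacket π θ)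
    (ha : T.IsTypeA θ) (hnd : (T.n π : ℚ) = T.dRep π / 2) : (T.m π : ℚ) = (T.dRep π : ℚ) / 2 * (1 + T.eps θ π) := by
  have h1 : T.n π = T.nOneTorus θ π := hn.2.1 π θ hπ ha
  have h2 : ((T.eNum (T.torusOf θ) π : ℕ) : ℚ) * (T.mu (T.torusOf θ) : ℚ) = 2 * (T.dRep π : ℚ) := by
    exact_mod_cast he π θ hπ ha
  rw [h1, MultiplicityTable.nOneTorus] at hnd
  linear_combination hnd + (1 / 4 : ℚ) * (T.eps θ π : ℚ) * h2

/-- **PROPOSITION 6.8, second formula from the first** («When `θ` is of type (b) `e(π) µ(T′) = d(π)`», reissue p. 56): from `nSpec` (iii)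
(`n(π) = m(π) − ¼ Σ_i ε_{i,π} e_i(π) µ(T′_i)`), the observation for each `θ i` (of type (b)) and `n(π) = d(π)/4`, the multiplicity is
`m(π) = (d(π)/4)(1 + ε_{1,π} + ε_{2,π} + ε_{3,π})`. [cite: LabesseLanglands1979, Proposition 6.8 (reissue p. 56)] -/
theorem LabesseLanglands1979_6_8_mFormula (hn : T.nSpec) (he : T.typeB_eMu) {π : T.Rep} {θ : Fin 3 → T.Ch} (hb : T.IsRepTypeB π)
    (hinj : Function.Injective fun i => T.torusOf (θ i)) (hπ : ∀ i, T.inPacket π (θ i)) (hθ : ∀ i, T.IsTypeB (θ i))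
    (hnd : (T.n π : ℚ) = T.dRep π / 4) :
    (T.m π : ℚ) = (T.dRep π : ℚ) / 4 * (1 + ∑ i : Fin 3, (T.eps (θ i) π : ℚ)) := by
  have h1 : T.n π = T.nThreeTori θ π := (hn.2.2 π hb).2 θ hinj hπ
  have h2 : ∀ i, ((T.eNum (T.torusOf (θ i)) π : ℕ) : ℚ) * (T.mu (T.torusOf (θ i)) : ℚ) = (T.dRep π : ℚ) := fun i => by
    exact_mod_cast he π (θ i) (hπ i) (hθ i)
  rw [h1, MultiplicityTable.nThreeTori] at hnd
  simp only [Fin.sum_univ_three] at hnd ⊢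
  linear_combination hnd + (1 / 4 : ℚ) * ((T.eps (θ 0) π : ℚ) * h2 0 + (T.eps (θ 1) π : ℚ) * h2 1 + (T.eps (θ 2) π : ℚ) * h2 2)

end QTable

end Literature.NumberTheory.Automorphic.LabesseLanglands1979.Sec6

end
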